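import Literature.NumberTheory.Automorphic.TorusOrbitalDescentUnitCanonical   -- ★ p840285 (F0P3b-p01 (g6)): the unit case; brings ★ `TorusOrbitalDescentTwist`, ★ `InvariantQuotientCompactOpenMass`, ★ `InvariantQuotientTransport`
import Literature.NumberTheory.Automorphic.LocalOrbitalIntegral               -- ★ `orbitalIntegral`
import HarnessLib

/-!
# Torus descent of orbital integrals against the CANONICAL quotient measure `ν∕t_T` — general test function, general Haar `ν`,
# with the Iwasawa constant EXPLICIT: `O_t(φ) = (ν(K) ∕ (κ(K)·μ_N(N ∩ K))) · J(t) · ∫_{K×N} φ(k (t n) k⁻¹)`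
(Rogawski (1990), §4.13 Lemma 4.13.1 (a) p. 64 and its proof p. 70 «`G = KP`, `P = MU`, `dg = dk dm du`»; §4.3 (4.3.1) p. 43 compatible
measures; §4.9 p. 54; Deitmar–Echterhoff (2014) Thm. 1.5.3; Gelbart (1975) Thm. 9.22 (iii))

Topic `NumberTheory/Automorphic`; namespace `Literature.NumberTheory.Automorphic`.  KERNEL mathematics only: theorems, no definition, no named
fact, no instance, no `sorry`.  Cell `pub/hodgecm-mathlib`, line «CMCharIdentityTest» (F0P3b), desk F0P3b-plan (g12) PLAN v14 §10 brick **S0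
«CONVENTIONS JOINT»**, FILE 1 (generic); seat F0P3b-p01 (g7).  HONEST LABEL: HC_CM is proved only modulo the 2 remaining named inputs (hLiu418,
h413) until rung 0 closes; this file discharges no named fact.

THE POINT.  ★ `TorusOrbitalDescentUnitCanonical` (my lineage, g6) pinned the UNSPECIFIED Iwasawa constant `C` of ★ `KNAQuotientIntegration` ∕ ★
`TorusOrbitalDescentTwist` for the CANONICAL quotient measure `ν∕t_T` of ★ `quotientMeasure`, in the normalised case `ν(K) = t_T(T ∩ K) = 1` and for the
UNIT `1_K`.  The (N-492) road (van Dijk's character formula against canonical orbital integrals) needs the same pin for an ARBITRARY Haar measure `ν`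
(the stub's `νG v` is not normalised) and an ARBITRARY integrand.  With `hμC : ν∕t_T = C • ((k, n) ↦ k n T)_*(κ ⊗ μ_N)`, `K` a compact open subgroup in
good position (`m u ∈ K ⇒ m ∈ K` for `m ∈ T`, `u ∈ N`), `T` normalising `N`:
* §1 **`coe_mul_measure_mul_measure_mul_measure_eq_of_quotientMeasure_eq_smul_map`**: `C · κ(K) · μ_N(N ∩ K) · t_T(T ∩ K) = ν(K)` (both sides are the
  mass of `π(K)`: ★ `quotientMeasure_image_mk_mul_eq` and the Iwasawa preimage ★ `preimage_mk_mul_image_eq_univ_prod`); hence, for `t_T` CANONICAL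
  (`t_T(T ∩ K) = 1`), **`coe_eq_measure_div_of_quotientMeasure_eq_smul_map`**: `C = ν(K) ∕ (κ(K) · μ_N(N ∩ K))`.
* §2 **`map_descConj_id_quotientMeasure_eq_smul_map_prod`** — THE MEASURE IDENTITY on `G`: for `t ∈ G` centralised by `T` with twist module `J` on `N`
  (the property binder `hJac` of ★ `TorusOrbitalDescentTwist`), `(ν∕t_T).map (yT ↦ y t y⁻¹) = (C·J) • (κ ⊗ μ_N).map ((k, n) ↦ k (t n) k⁻¹)`, and its
  readings: **`lintegral_descConj_quotientMeasure_eq_mul_lintegral_prod`** (`[0,∞]`-valued, `C` explicit) and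
  **`orbitalIntegral_quotientMeasure_eq_smul_integral_prod`** (Bochner, `φ : G → ℂ` measurable):
  `O_t(φ; ν∕t_T) = ((ν(K) ∕ (κ(K)·μ_N(N ∩ K))) · J).toReal • ∫_{K×N} φ(k (t n) k⁻¹) d(κ ⊗ μ_N)`.
* §3 TRANSPORT along a bicontinuous `Ψ : G′ ≃* G` carrying `Z(γ₀)` onto `T` (`ν = Ψ_*ν′`, `t_T = Ψ_*t_Z`):
  **`map_descConj_id_centralizer_quotientMeasure_eq_smul_map_of_mulEquiv`** and **`orbitalIntegral_centralizer_quotientMeasure_eq_smul_integral_of_mulEquiv`**: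
  `O_{γ₀}(φ; ν′∕t_Z) = ((ν(K) ∕ (κ(K)·μ_N(N ∩ K))) · J).toReal • ∫_{K×N} φ(Ψ⁻¹(k (Ψγ₀ · n) k⁻¹))` — the shape in which the inner form
  `U(H)(L⁺_v) ≃ U(Φ₃)(L⁺_v)` (★ `cmDatumLocalCongr`) is consumed by FILE 2 (★-to-be `UnitaryGroupTorusOrbitalIntegralCanonical`).
Print: [Rogawski1990 §4.13 p. 70] «`dg = dk dm du`», [§4.3 (4.3.1)] «the orbital integrals are defined using compatible measures»; Deitmar–Echterhoff
Thm. 1.5.3 (quotient integral formula); Gelbart Thm. 9.22 (iii).  NOT here: the value of `J` (★ A-p12), the CM carriers, canonical FAMILIES (FILE 2).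

## References
* [Rogawski1990] J. D. Rogawski, *Automorphic Representations of Unitary Groups in Three Variables*, Ann. of Math. Stud. 123 (1990), §4.13
  Lemma 4.13.1 (a) p. 64, proof p. 70; §4.3 (4.3.1) p. 43; §4.9 p. 54.
* [DeitmarEchterhoff2014] A. Deitmar, S. Echterhoff, *Principles of Harmonic Analysis*, 2nd ed. (2014), Thm. 1.5.3.
* [Gelbart1975] S. Gelbart, *Automorphic Forms on Adele Groups*, Ann. of Math. Stud. 83 (1975), Thm. 9.22 (iii), Remark 9.23.
-/

set_option autoImplicit false

noncomputable section

open MeasureTheory Measure Set Filter Topology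
open scoped ENNReal NNReal

namespace Literature.NumberTheory.Automorphic

open Literature.MeasureTheory.Group

universe u

/-! ## §1 The Iwasawa constant of `ν∕t_T` for a general Haar measure `ν` -/

section Generic

variable {G : Type u} [Group G] [TopologicalSpace G] [IsTopologicalGroup G] [LocallyCompactSpace G]
  [T2Space G] [SecondCountableTopology G] [MeasurableSpace G] [BorelSpace G]
  {K T N : Subgroup G} (hKo : IsOpen (K : Set G)) (hKc : IsCompact (K : Set G)) (hT : IsClosed (T : Set G))
  (hTN : ∀ a ∈ T, ∀ n ∈ N, a * n * a⁻¹ ∈ N)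
  (hKP : ∀ ⦃m u : G⦄, m ∈ T → u ∈ N → m * u ∈ K → m ∈ K)
  (ν : Measure G) [IsHaarMeasure ν] [ν.IsMulRightInvariant]
  (tT : Measure ↥T) [tT.IsHaarMeasure] [tT.IsInvInvariant]
  (κ : Measure ↥K) (μN : Measure ↥N) [SFinite μN]
  [MeasurableSpace (G ⧸ T)] [BorelSpace (G ⧸ T)]

include hKo hTN hKP in
/-- **THE IWASAWA CONSTANT OF `ν∕t_T` IS PINNED BY THE `K`-MASSES (general Haar `ν`)**: if `ν∕t_T = C • ((k, n) ↦ k n T)_* (κ ⊗ μ_N)` on `G ⧸ T`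
then `C · κ(K) · μ_N(N ∩ K) · t_T(T ∩ K) = ν(K)` — both sides are the mass of the open set `π(K)` (★ `quotientMeasure_image_mk_mul_eq`:
`(ν∕t_T)(π(K)) · t_T(T ∩ K) = ν(K)`; the Iwasawa preimage of `π(K)` is `K × (N ∩ K)`, ★ `preimage_mk_mul_image_eq_univ_prod`).
[cite: Rogawski1990, §4.13, proof of Lemma 4.13.1, p. 70] [cite: DeitmarEchterhoff2014, Thm. 1.5.3] -/
theorem coe_mul_measure_mul_measure_mul_measure_eq_of_quotientMeasure_eq_smul_map {C : ℝ≥0}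
    (hμC : quotientMeasure T tT hT ν = C • Measure.map (fun p : ↥K × ↥N => (QuotientGroup.mk ((p.1 : G) * (p.2 : G)) : G ⧸ T)) (κ.prod μN)) :
    (C : ℝ≥0∞) * (κ univ * μN {n : ↥N | (n : G) ∈ K}) * tT (Subtype.val ⁻¹' (K : Set G)) = ν K := by
  haveI : SecondCountableTopology ↥K := TopologicalSpace.Subtype.secondCountableTopology _
  haveI : SecondCountableTopology ↥N := TopologicalSpace.Subtype.secondCountableTopology _
  haveI : BorelSpace (↥K × ↥N) := Prod.borelSpace
  have h1 := quotientMeasure_image_mk_mul_eq T tT ν K hKo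
  have hmk : Measurable fun p : ↥K × ↥N => (QuotientGroup.mk ((p.1 : G) * (p.2 : G)) : G ⧸ T) :=
    (continuous_quotient_mk'.comp ((continuous_subtype_val.comp continuous_fst).mul
      (continuous_subtype_val.comp continuous_snd))).measurable
  have hopen : MeasurableSet ((QuotientGroup.mk : G → G ⧸ T) '' (K : Set G)) :=
    (QuotientGroup.isOpenMap_coe (K : Set G) hKo).measurableSet
  rw [hμC, Measure.smul_apply, Measure.map_apply hmk hopen, preimage_mk_mul_image_eq_univ_prod hTN hKP,
    Measure.prod_prod, ENNReal.smul_def, smul_eq_mul] at h1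
  exact h1

include hKo hKc hTN hKP in
/-- **THE IWASAWA CONSTANT OF THE CANONICAL QUOTIENT MEASURE, EXPLICIT**: for `t_T` normalised by `t_T(T ∩ K) = 1` (the canonical torus measure
of ★ `OrbitalMeasureFamily.IsCanonical` once `compactCore T = T ∩ K`), `ν∕t_T = C • ((k, n) ↦ k n T)_* (κ ⊗ μ_N)` forces
**`C = ν(K) ∕ (κ(K) · μ_N(N ∩ K))`** (`K` compact open: `0 < ν(K) < ∞`, so `C ≠ 0` and the denominator is neither `0` nor `∞`).
[cite: Rogawski1990, §4.13, proof of Lemma 4.13.1, p. 70; §4.3 (4.3.1) p. 43] [cite: DeitmarEchterhoff2014, Thm. 1.5.3] -/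
theorem coe_eq_measure_div_of_quotientMeasure_eq_smul_map {C : ℝ≥0}
    (hμC : quotientMeasure T tT hT ν = C • Measure.map (fun p : ↥K × ↥N => (QuotientGroup.mk ((p.1 : G) * (p.2 : G)) : G ⧸ T)) (κ.prod μN))
    (htK : tT (Subtype.val ⁻¹' (K : Set G)) = 1) :
    (C : ℝ≥0∞) = ν K / (κ univ * μN {n : ↥N | (n : G) ∈ K}) := by
  have h := coe_mul_measure_mul_measure_mul_measure_eq_of_quotientMeasure_eq_smul_map hKo hT hTN hKP ν tT κ μN hμC
  rw [htK, mul_one] at h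
  have hνpos : ν K ≠ 0 := (hKo.measure_pos ν ⟨1, K.one_mem⟩).ne'
  have hνtop : ν K ≠ ⊤ := hKc.measure_lt_top.ne
  have hX0 : κ univ * μN {n : ↥N | (n : G) ∈ K} ≠ 0 := by
    intro h0
    rw [h0, mul_zero] at h
    exact hνpos h.symm
  have hC0 : (C : ℝ≥0∞) ≠ 0 := by
    intro h0
    rw [h0, zero_mul] at h
    exact hνpos h.symm
  have hXtop : κ univ * μN {n : ↥N | (n : G) ∈ K} ≠ ⊤ := by
    intro htop
    rw [htop, ENNReal.mul_top hC0] at h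
    exact hνtop h.symm
  rw [ENNReal.eq_div_iff hX0 hXtop, mul_comm]
  exact h

/-! ## §2 The orbital MEASURE of `t` against `ν∕t_T` in Iwasawa coordinates, and its two readings -/

omit [LocallyCompactSpace G] [T2Space G] [SecondCountableTopology G] in
/-- The orbit map `yT ↦ y t y⁻¹` (`descConj t T _ id`) is Borel on `G ⧸ T` (for the Borel σ-algebra of the quotient). [cite: Folland1995, §2.6 Thm. 2.49] -/
theorem measurable_descConj_id (t : G) (ht : ∀ a ∈ T, a * t = t * a) : Measurable (descConj t T ht (id : G → G)) :=
  measurable_descConj t T ht measurable_id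

include hT in
/-- **THE ORBITAL MEASURE OF `t` IN IWASAWA COORDINATES** (any invariant `μ` of the form `C • ((k,n) ↦ k n T)_*(κ ⊗ μ_N)`, any `t` centralised by `T`
with twist module `J` on `N`): `μ.map (yT ↦ y t y⁻¹) = (C·J) • (κ ⊗ μ_N).map ((k, n) ↦ k (t n) k⁻¹)` as measures on `G` — ★
`lintegral_descConj_eq_mul_lintegral_prod_torus_mul_unipotent_of_eq_smul_map` evaluated on indicators.
[cite: Rogawski1990, §4.13 Lemma 4.13.1 (a) p. 64 and p. 70] [cite: Gelbart1975, Thm. 9.22 (iii)] -/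
theorem map_descConj_id_eq_smul_map_prod_of_eq_smul_map (μ : Measure (G ⧸ T)) {C : ℝ≥0}
    (hμC : μ = C • Measure.map (fun p : ↥K × ↥N => (QuotientGroup.mk ((p.1 : G) * (p.2 : G)) : G ⧸ T)) (κ.prod μN))
    (t : G) (ht : ∀ a ∈ T, a * t = t * a) {J : ℝ≥0∞}
    (hJac : ∀ Φ : G → ℝ≥0∞, Measurable Φ → ∫⁻ n, Φ ((n : G) * t * (n : G)⁻¹) ∂μN = J * ∫⁻ n, Φ (t * (n : G)) ∂μN) :
    μ.map (descConj t T ht (id : G → G)) =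
      ((C : ℝ≥0∞) * J) • (κ.prod μN).map (fun p : ↥K × ↥N => (p.1 : G) * (t * (p.2 : G)) * (p.1 : G)⁻¹) := by
  haveI : SecondCountableTopology ↥K := TopologicalSpace.Subtype.secondCountableTopology _
  haveI : SecondCountableTopology ↥N := TopologicalSpace.Subtype.secondCountableTopology _
  haveI : BorelSpace (↥K × ↥N) := Prod.borelSpace
  have hf : Measurable fun p : ↥K × ↥N => (p.1 : G) * (t * (p.2 : G)) * (p.1 : G)⁻¹ :=
    ((((continuous_subtype_val.comp continuous_fst).mul
      (continuous_const.mul (continuous_subtype_val.comp continuous_snd))).mul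
      (continuous_subtype_val.comp continuous_fst).inv).measurable)
  ext s hs
  rw [← lintegral_indicator_one hs, lintegral_map (measurable_one.indicator hs) (measurable_descConj_id t ht),
    Measure.smul_apply, smul_eq_mul, ← lintegral_indicator_one hs, lintegral_map (measurable_one.indicator hs) hf]
  have h1 : (fun y => s.indicator (1 : G → ℝ≥0∞) (descConj t T ht id y)) = descConj t T ht (s.indicator 1) := by
    rw [descConj_eq_comp t T ht (s.indicator (1 : G → ℝ≥0∞))]
    rfl
  rw [h1, lintegral_descConj_eq_mul_lintegral_prod_torus_mul_unipotent_of_eq_smul_map hT κ μN μ hμC t ht hJac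
    (measurable_one.indicator hs)]

include hKo hKc hT hTN hKP in
/-- **THE ORBITAL MEASURE OF `t` AGAINST THE CANONICAL QUOTIENT MEASURE, CONSTANT EXPLICIT**: with `t_T(T ∩ K) = 1`,
`(ν∕t_T).map (yT ↦ y t y⁻¹) = ((ν(K) ∕ (κ(K)·μ_N(N ∩ K))) · J) • (κ ⊗ μ_N).map ((k, n) ↦ k (t n) k⁻¹)`.
[cite: Rogawski1990, §4.13 Lemma 4.13.1 (a) p. 64 and p. 70; §4.3 (4.3.1) p. 43] [cite: DeitmarEchterhoff2014, Thm. 1.5.3] -/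
theorem map_descConj_id_quotientMeasure_eq_smul_map_prod {C : ℝ≥0}
    (hμC : quotientMeasure T tT hT ν = C • Measure.map (fun p : ↥K × ↥N => (QuotientGroup.mk ((p.1 : G) * (p.2 : G)) : G ⧸ T)) (κ.prod μN))
    (htK : tT (Subtype.val ⁻¹' (K : Set G)) = 1)
    (t : G) (ht : ∀ a ∈ T, a * t = t * a) {J : ℝ≥0∞}
    (hJac : ∀ Φ : G → ℝ≥0∞, Measurable Φ → ∫⁻ n, Φ ((n : G) * t * (n : G)⁻¹) ∂μN = J * ∫⁻ n, Φ (t * (n : G)) ∂μN) :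
    (quotientMeasure T tT hT ν).map (descConj t T ht (id : G → G)) =
      ((ν K / (κ univ * μN {n : ↥N | (n : G) ∈ K})) * J) •
        (κ.prod μN).map (fun p : ↥K × ↥N => (p.1 : G) * (t * (p.2 : G)) * (p.1 : G)⁻¹) := by
  rw [map_descConj_id_eq_smul_map_prod_of_eq_smul_map hT κ μN _ hμC t ht hJac,
    coe_eq_measure_div_of_quotientMeasure_eq_smul_map hKo hKc hT hTN hKP ν tT κ μN hμC htK]

include hKo hKc hT hTN hKP in
/-- **TORUS DESCENT AGAINST THE CANONICAL QUOTIENT MEASURE, `[0, ∞]`-valued**: with `t_T(T ∩ K) = 1`, for every Borel `F ≥ 0`,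
`∫⁻_{G⧸T} F(y t y⁻¹) d(ν∕t_T) = (ν(K) ∕ (κ(K)·μ_N(N ∩ K))) · J · ∫⁻_{K×N} F(k (t n) k⁻¹) d(κ ⊗ μ_N)`.
[cite: Rogawski1990, §4.13 Lemma 4.13.1 (a) p. 64 and p. 70; §4.9 p. 54] [cite: DeitmarEchterhoff2014, Thm. 1.5.3] -/
theorem lintegral_descConj_quotientMeasure_eq_mul_lintegral_prod {C : ℝ≥0}
    (hμC : quotientMeasure T tT hT ν = C • Measure.map (fun p : ↥K × ↥N => (QuotientGroup.mk ((p.1 : G) * (p.2 : G)) : G ⧸ T)) (κ.prod μN))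
    (htK : tT (Subtype.val ⁻¹' (K : Set G)) = 1)
    (t : G) (ht : ∀ a ∈ T, a * t = t * a) {J : ℝ≥0∞}
    (hJac : ∀ Φ : G → ℝ≥0∞, Measurable Φ → ∫⁻ n, Φ ((n : G) * t * (n : G)⁻¹) ∂μN = J * ∫⁻ n, Φ (t * (n : G)) ∂μN)
    {F : G → ℝ≥0∞} (hF : Measurable F) :
    ∫⁻ y, descConj t T ht F y ∂(quotientMeasure T tT hT ν) =
      (ν K / (κ univ * μN {n : ↥N | (n : G) ∈ K})) * J *
        ∫⁻ p : ↥K × ↥N, F ((p.1 : G) * (t * (p.2 : G)) * (p.1 : G)⁻¹) ∂(κ.prod μN) := by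
  rw [lintegral_descConj_eq_mul_lintegral_prod_torus_mul_unipotent_of_eq_smul_map hT κ μN _ hμC t ht hJac hF,
    coe_eq_measure_div_of_quotientMeasure_eq_smul_map hKo hKc hT hTN hKP ν tT κ μN hμC htK]

include hKo hKc hT hTN hKP in
/-- **TORUS DESCENT OF THE ORBITAL INTEGRAL AGAINST THE CANONICAL QUOTIENT MEASURE** (Bochner, `ℂ`-valued measurable `φ`): with `t_T(T ∩ K) = 1`,
`O_t(φ; ν∕t_T) = ∫_{G⧸T} φ(y t y⁻¹) d(ν∕t_T) = ((ν(K) ∕ (κ(K)·μ_N(N ∩ K))) · J).toReal • ∫_{K×N} φ(k (t n) k⁻¹) d(κ ⊗ μ_N)` — [Rogawski1990 §4.13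
p. 70] «`dg = dk dm du`» with the compatible measures of §4.3 (no integrability hypothesis: both sides are integrals against image measures of one
another, `integral_map`). [cite: Rogawski1990, §4.13 Lemma 4.13.1 (a) p. 64 and p. 70; §4.3 (4.3.1) p. 43; §4.9 p. 54] [cite: DeitmarEchterhoff2014, Thm. 1.5.3] -/
theorem orbitalIntegral_quotientMeasure_eq_smul_integral_prod {C : ℝ≥0}
    (hμC : quotientMeasure T tT hT ν = C • Measure.map (fun p : ↥K × ↥N => (QuotientGroup.mk ((p.1 : G) * (p.2 : G)) : G ⧸ T)) (κ.prod μN))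
    (htK : tT (Subtype.val ⁻¹' (K : Set G)) = 1)
    (t : G) (ht : ∀ a ∈ T, a * t = t * a) {J : ℝ≥0∞}
    (hJac : ∀ Φ : G → ℝ≥0∞, Measurable Φ → ∫⁻ n, Φ ((n : G) * t * (n : G)⁻¹) ∂μN = J * ∫⁻ n, Φ (t * (n : G)) ∂μN)
    {φ : G → ℂ} (hφ : Measurable φ) :
    ∫ y, descConj t T ht φ y ∂(quotientMeasure T tT hT ν) =
      ((ν K / (κ univ * μN {n : ↥N | (n : G) ∈ K})) * J).toReal •
        ∫ p : ↥K × ↥N, φ ((p.1 : G) * (t * (p.2 : G)) * (p.1 : G)⁻¹) ∂(κ.prod μN) := by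
  haveI : SecondCountableTopology ↥K := TopologicalSpace.Subtype.secondCountableTopology _
  haveI : SecondCountableTopology ↥N := TopologicalSpace.Subtype.secondCountableTopology _
  haveI : BorelSpace (↥K × ↥N) := Prod.borelSpace
  have hf : Measurable fun p : ↥K × ↥N => (p.1 : G) * (t * (p.2 : G)) * (p.1 : G)⁻¹ :=
    ((((continuous_subtype_val.comp continuous_fst).mul
      (continuous_const.mul (continuous_subtype_val.comp continuous_snd))).mul
      (continuous_subtype_val.comp continuous_fst).inv).measurable)
  have h1 : (fun y => descConj t T ht φ y) = fun y => φ (descConj t T ht id y) := by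
    funext y
    rw [descConj_eq_comp t T ht φ]
    rfl
  rw [h1, ← integral_map (measurable_descConj_id t ht).aemeasurable hφ.aestronglyMeasurable,
    map_descConj_id_quotientMeasure_eq_smul_map_prod hKo hKc hT hTN hKP ν tT κ μN hμC htK t ht hJac, integral_smul_measure,
    integral_map hf.aemeasurable hφ.aestronglyMeasurable]

end Generic

/-! ## §3 Transported form: the orbital integral at `γ₀ ∈ G′` against `ν′∕t_{Z(γ₀)}` read on `G ⧸ T` -/

section Transport

variable {G : Type u} [Group G] [TopologicalSpace G] [IsTopologicalGroup G] [LocallyCompactSpace G]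
  [T2Space G] [SecondCountableTopology G] [MeasurableSpace G] [BorelSpace G]
  {G' : Type u} [Group G'] [TopologicalSpace G'] [IsTopologicalGroup G'] [LocallyCompactSpace G']
  [T2Space G'] [SecondCountableTopology G'] [MeasurableSpace G'] [BorelSpace G']
  {K T N : Subgroup G} (hKo : IsOpen (K : Set G)) (hKc : IsCompact (K : Set G)) (hT : IsClosed (T : Set G))
  (hTN : ∀ a ∈ T, ∀ n ∈ N, a * n * a⁻¹ ∈ N)
  (hKP : ∀ ⦃m u : G⦄, m ∈ T → u ∈ N → m * u ∈ K → m ∈ K)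
  (ν : Measure G) [IsHaarMeasure ν] [ν.IsMulRightInvariant]
  (tT : Measure ↥T) [tT.IsHaarMeasure] [tT.IsInvInvariant]
  (κ : Measure ↥K) (μN : Measure ↥N) [SFinite μN]
  [MeasurableSpace (G ⧸ T)] [BorelSpace (G ⧸ T)]

include hT in
/-- **TRANSPORT OF THE ORBITAL MEASURE ALONG A GROUP ISOMORPHISM** (★ `map_cosetCongr_quotientMeasure`): for a bicontinuous `Ψ : G′ ≃* G` carrying the
centraliser `Z(γ₀)` onto `T`, with `ν = Ψ_* ν′` and `t_T = (Ψ|_{Z(γ₀)})_* t_Z`,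
`(ν′∕t_Z).map (y Z ↦ y γ₀ y⁻¹) = ((ν∕t_T).map (x T ↦ x (Ψγ₀) x⁻¹)).map Ψ⁻¹` as measures on `G′`.
[cite: DeitmarEchterhoff2014, Thm. 1.5.3] [cite: Rogawski1990, §4.3 (4.3.1) p. 43] -/
theorem map_descConj_id_centralizer_quotientMeasure_eq_map_symm_of_mulEquiv (Ψ : G' ≃* G) (hΨ : Continuous Ψ) (hΨs : Continuous Ψ.symm)
    (γ₀ : G') (hZT : ∀ g, Ψ g ∈ T ↔ g ∈ Subgroup.centralizer ({γ₀} : Set G'))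
    [MeasurableSpace (G' ⧸ Subgroup.centralizer ({γ₀} : Set G'))] [BorelSpace (G' ⧸ Subgroup.centralizer ({γ₀} : Set G'))]
    (ν' : Measure G') [IsHaarMeasure ν'] [ν'.IsMulRightInvariant] (hν' : ν = Measure.map Ψ ν')
    (tZ : Measure ↥(Subgroup.centralizer ({γ₀} : Set G'))) [tZ.IsHaarMeasure] [tZ.IsInvInvariant]
    (htZ : tT = Measure.map (subgroupCongrHomeomorph Ψ (Subgroup.centralizer ({γ₀} : Set G')) T hZT hΨ hΨs) tZ)
    (ht : ∀ a ∈ T, a * Ψ γ₀ = Ψ γ₀ * a) :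
    (quotientMeasure (Subgroup.centralizer ({γ₀} : Set G')) tZ (isClosed_coe_centralizer_singleton γ₀) ν').map
        (descConj γ₀ (Subgroup.centralizer ({γ₀} : Set G')) (fun _ hg => Subgroup.mem_centralizer_singleton_iff.1 hg) (id : G' → G')) =
      ((quotientMeasure T tT hT ν).map (descConj (Ψ γ₀) T ht (id : G → G))).map Ψ.symm := by
  haveI hZc : IsClosed ((Subgroup.centralizer ({γ₀} : Set G') : Subgroup G') : Set G') := isClosed_coe_centralizer_singleton γ₀
  haveI : IsClosed ((T : Subgroup G) : Set G) := hT
  have hcc : Measurable (cosetCongr Ψ (Subgroup.centralizer ({γ₀} : Set G')) T hZT) :=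
    (continuous_cosetCongr Ψ (Subgroup.centralizer ({γ₀} : Set G')) T hZT hΨ).measurable
  have hdT : Measurable (descConj (Ψ γ₀) T ht (id : G → G)) := measurable_descConj_id (Ψ γ₀) ht
  have hdZ : Measurable (descConj γ₀ (Subgroup.centralizer ({γ₀} : Set G')) (fun _ hg => Subgroup.mem_centralizer_singleton_iff.1 hg)
      (id : G' → G')) := measurable_descConj γ₀ _ _ measurable_id
  -- `Ψ⁻¹ ∘ (x T ↦ x (Ψγ₀) x⁻¹) ∘ cosetCongr Ψ = (y Z ↦ y γ₀ y⁻¹)`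
  have hcomp : (Ψ.symm : G → G') ∘ descConj (Ψ γ₀) T ht (id : G → G) ∘ cosetCongr Ψ (Subgroup.centralizer ({γ₀} : Set G')) T hZT =
      descConj γ₀ (Subgroup.centralizer ({γ₀} : Set G')) (fun _ hg => Subgroup.mem_centralizer_singleton_iff.1 hg) (id : G' → G') := by
    funext y
    induction y using QuotientGroup.induction_on with
    | H g => simp only [Function.comp_apply, cosetCongr_mk, descConj_mk, id, ← map_mul, ← map_inv, MulEquiv.symm_apply_apply]
  rw [← map_cosetCongr_quotientMeasure Ψ hΨ hΨs (Subgroup.centralizer ({γ₀} : Set G')) T hZT tZ tT ν' ν htZ hν',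
    Measure.map_map hdT hcc, Measure.map_map hΨs.measurable (hdT.comp hcc), hcomp]

include hKo hKc hT hTN hKP in
/-- **THE ORBITAL MEASURE AT `γ₀ ∈ G′` AGAINST THE CANONICAL `ν′∕t_Z`, IN THE IWASAWA COORDINATES OF `G`**: under the hypotheses of
`map_descConj_id_quotientMeasure_eq_smul_map_prod` at `t := Ψ γ₀` (constant pinned by `t_T(T ∩ K) = 1`),
`(ν′∕t_Z).map (y Z ↦ y γ₀ y⁻¹) = ((ν(K) ∕ (κ(K)·μ_N(N ∩ K))) · J) • (κ ⊗ μ_N).map ((k, n) ↦ Ψ⁻¹ (k (Ψγ₀ · n) k⁻¹))`.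
[cite: Rogawski1990, §4.13 Lemma 4.13.1 (a) p. 64 and p. 70; §4.3 (4.3.1) p. 43] [cite: DeitmarEchterhoff2014, Thm. 1.5.3] -/
theorem map_descConj_id_centralizer_quotientMeasure_eq_smul_map_of_mulEquiv (Ψ : G' ≃* G) (hΨ : Continuous Ψ) (hΨs : Continuous Ψ.symm)
    (γ₀ : G') (hZT : ∀ g, Ψ g ∈ T ↔ g ∈ Subgroup.centralizer ({γ₀} : Set G'))
    [MeasurableSpace (G' ⧸ Subgroup.centralizer ({γ₀} : Set G'))] [BorelSpace (G' ⧸ Subgroup.centralizer ({γ₀} : Set G'))]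
    (ν' : Measure G') [IsHaarMeasure ν'] [ν'.IsMulRightInvariant] (hν' : ν = Measure.map Ψ ν')
    (tZ : Measure ↥(Subgroup.centralizer ({γ₀} : Set G'))) [tZ.IsHaarMeasure] [tZ.IsInvInvariant]
    (htZ : tT = Measure.map (subgroupCongrHomeomorph Ψ (Subgroup.centralizer ({γ₀} : Set G')) T hZT hΨ hΨs) tZ)
    {C : ℝ≥0}
    (hμC : quotientMeasure T tT hT ν = C • Measure.map (fun p : ↥K × ↥N => (QuotientGroup.mk ((p.1 : G) * (p.2 : G)) : G ⧸ T)) (κ.prod μN))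
    (htK : tT (Subtype.val ⁻¹' (K : Set G)) = 1)
    (ht : ∀ a ∈ T, a * Ψ γ₀ = Ψ γ₀ * a) {J : ℝ≥0∞}
    (hJac : ∀ Φ : G → ℝ≥0∞, Measurable Φ → ∫⁻ n, Φ ((n : G) * Ψ γ₀ * (n : G)⁻¹) ∂μN = J * ∫⁻ n, Φ (Ψ γ₀ * (n : G)) ∂μN) :
    (quotientMeasure (Subgroup.centralizer ({γ₀} : Set G')) tZ (isClosed_coe_centralizer_singleton γ₀) ν').map
        (descConj γ₀ (Subgroup.centralizer ({γ₀} : Set G')) (fun _ hg => Subgroup.mem_centralizer_singleton_iff.1 hg) (id : G' → G')) =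
      ((ν K / (κ univ * μN {n : ↥N | (n : G) ∈ K})) * J) •
        (κ.prod μN).map (fun p : ↥K × ↥N => Ψ.symm ((p.1 : G) * (Ψ γ₀ * (p.2 : G)) * (p.1 : G)⁻¹)) := by
  haveI : SecondCountableTopology ↥K := TopologicalSpace.Subtype.secondCountableTopology _
  haveI : SecondCountableTopology ↥N := TopologicalSpace.Subtype.secondCountableTopology _
  haveI : BorelSpace (↥K × ↥N) := Prod.borelSpace
  have hf : Measurable fun p : ↥K × ↥N => (p.1 : G) * (Ψ γ₀ * (p.2 : G)) * (p.1 : G)⁻¹ :=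
    ((((continuous_subtype_val.comp continuous_fst).mul
      (continuous_const.mul (continuous_subtype_val.comp continuous_snd))).mul
      (continuous_subtype_val.comp continuous_fst).inv).measurable)
  rw [map_descConj_id_centralizer_quotientMeasure_eq_map_symm_of_mulEquiv hT ν tT Ψ hΨ hΨs γ₀ hZT ν' hν' tZ htZ ht,
    map_descConj_id_quotientMeasure_eq_smul_map_prod hKo hKc hT hTN hKP ν tT κ μN hμC htK (Ψ γ₀) ht hJac, Measure.map_smul,
    Measure.map_map hΨs.measurable hf]
  rfl

include hKo hKc hT hTN hKP in
/-- **THE ORBITAL INTEGRAL AT `γ₀ ∈ G′` AGAINST THE CANONICAL `ν′∕t_Z`, IN THE IWASAWA COORDINATES OF `G`** (Bochner, `ℂ`-valued measurable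
`φ`): `O_{γ₀}(φ; ν′∕t_Z) = ((ν(K) ∕ (κ(K)·μ_N(N ∩ K))) · J).toReal • ∫_{K×N} φ(Ψ⁻¹(k (Ψγ₀ · n) k⁻¹)) d(κ ⊗ μ_N)` — the shape in which the
inner form `U(H)(L⁺_v) ≃ U(Φ₃)(L⁺_v)` of the CM letters is consumed. [cite: Rogawski1990, §4.13 Lemma 4.13.1 (a) p. 64 and p. 70; §4.3 (4.3.1) p. 43; §4.9 p. 54]
[cite: DeitmarEchterhoff2014, Thm. 1.5.3] -/
theorem orbitalIntegral_centralizer_quotientMeasure_eq_smul_integral_of_mulEquiv (Ψ : G' ≃* G) (hΨ : Continuous Ψ) (hΨs : Continuous Ψ.symm)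
    (γ₀ : G') (hZT : ∀ g, Ψ g ∈ T ↔ g ∈ Subgroup.centralizer ({γ₀} : Set G'))
    [MeasurableSpace (G' ⧸ Subgroup.centralizer ({γ₀} : Set G'))] [BorelSpace (G' ⧸ Subgroup.centralizer ({γ₀} : Set G'))]
    (ν' : Measure G') [IsHaarMeasure ν'] [ν'.IsMulRightInvariant] (hν' : ν = Measure.map Ψ ν')
    (tZ : Measure ↥(Subgroup.centralizer ({γ₀} : Set G'))) [tZ.IsHaarMeasure] [tZ.IsInvInvariant]
    (htZ : tT = Measure.map (subgroupCongrHomeomorph Ψ (Subgroup.centralizer ({γ₀} : Set G')) T hZT hΨ hΨs) tZ)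
    {C : ℝ≥0}
    (hμC : quotientMeasure T tT hT ν = C • Measure.map (fun p : ↥K × ↥N => (QuotientGroup.mk ((p.1 : G) * (p.2 : G)) : G ⧸ T)) (κ.prod μN))
    (htK : tT (Subtype.val ⁻¹' (K : Set G)) = 1)
    (ht : ∀ a ∈ T, a * Ψ γ₀ = Ψ γ₀ * a) {J : ℝ≥0∞}
    (hJac : ∀ Φ : G → ℝ≥0∞, Measurable Φ → ∫⁻ n, Φ ((n : G) * Ψ γ₀ * (n : G)⁻¹) ∂μN = J * ∫⁻ n, Φ (Ψ γ₀ * (n : G)) ∂μN)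
    {φ : G' → ℂ} (hφ : Measurable φ) :
    orbitalIntegral γ₀ φ (quotientMeasure (Subgroup.centralizer ({γ₀} : Set G')) tZ (isClosed_coe_centralizer_singleton γ₀) ν') =
      ((ν K / (κ univ * μN {n : ↥N | (n : G) ∈ K})) * J).toReal •
        ∫ p : ↥K × ↥N, φ (Ψ.symm ((p.1 : G) * (Ψ γ₀ * (p.2 : G)) * (p.1 : G)⁻¹)) ∂(κ.prod μN) := by
  haveI : SecondCountableTopology ↥K := TopologicalSpace.Subtype.secondCountableTopology _
  haveI : SecondCountableTopology ↥N := TopologicalSpace.Subtype.secondCountableTopology _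
  haveI : BorelSpace (↥K × ↥N) := Prod.borelSpace
  haveI hZc : IsClosed ((Subgroup.centralizer ({γ₀} : Set G') : Subgroup G') : Set G') := isClosed_coe_centralizer_singleton γ₀
  have hf : Measurable fun p : ↥K × ↥N => Ψ.symm ((p.1 : G) * (Ψ γ₀ * (p.2 : G)) * (p.1 : G)⁻¹) :=
    hΨs.measurable.comp ((((continuous_subtype_val.comp continuous_fst).mul
      (continuous_const.mul (continuous_subtype_val.comp continuous_snd))).mul
      (continuous_subtype_val.comp continuous_fst).inv).measurable)
  have hdZ : Measurable (descConj γ₀ (Subgroup.centralizer ({γ₀} : Set G')) (fun _ hg => Subgroup.mem_centralizer_singleton_iff.1 hg)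
      (id : G' → G')) := measurable_descConj γ₀ _ _ measurable_id
  have h1 : (fun y => descConj γ₀ (Subgroup.centralizer ({γ₀} : Set G')) (fun _ hg => Subgroup.mem_centralizer_singleton_iff.1 hg) φ y) =
      fun y => φ (descConj γ₀ (Subgroup.centralizer ({γ₀} : Set G')) (fun _ hg => Subgroup.mem_centralizer_singleton_iff.1 hg) id y) := by
    funext y
    rw [descConj_eq_comp γ₀ _ _ φ]
    rfl
  rw [orbitalIntegral_eq_integral_descConj, h1, ← integral_map hdZ.aemeasurable hφ.aestronglyMeasurable,
    map_descConj_id_centralizer_quotientMeasure_eq_smul_map_of_mulEquiv hKo hKc hT hTN hKP ν tT κ μN Ψ hΨ hΨs γ₀ hZT ν' hν' tZ htZ hμC htK ht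
      hJac,
    integral_smul_measure, integral_map hf.aemeasurable hφ.aestronglyMeasurable]

end Transport

end Literature.NumberTheory.Automorphic

end
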